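import Literature.MathematicalPhysics.QuantumFieldTheory.Balaban1983to89.B8Thm2TorusServerPer
import Literature.MathematicalPhysics.QuantumFieldTheory.Balaban1983to89.B8Thm2TorusServerP3
import Literature.MathematicalPhysics.QuantumFieldTheory.Balaban1983to89.B8Prop5UniqSectEWPer

/-!
# `Balaban1983to89.B8Thm2TorusUniqPer` — [Balaban1985RegularSpaces] Prop. 5 (1.109) p. 94 ∕ Thm 4 p. 95 on `T_η`, v3 (RULING #4: the [4]
# letters' (U1), (U2), (1.91) read at `P`-PERIODIC ARGUMENTS ONLY): route P's Theorem-2-level uniqueness socket `SockP5Uniq` of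
# `B8Thm2TorusSupplier.Thm2TorusSockets … G` for ONE periodic `G`-valued background, SERVED FROM THE v3 LETTERS `LettersAtPer` (sub-row
# «G-B8-T2S», layer 3(h) of `lit-balaban-t2s-1/g2/V3-DESIGN.md`)

statement-level skeleton of published theorems with citation tags; proofs where landed; nothing here is a claim about the
Yang–Mills mass gap

T. Bałaban, *Spaces of regular gauge field configurations on a lattice and gauge fixing conditions*, Commun. Math. Phys. **99** (1985) 75–102
`[Balaban1985RegularSpaces]` ("B8"): Prop. 5 (1.107)–(1.109) p. 94, Thm 4 p. 88, p. 95 (the uniqueness paragraph: «thus u′ is a solution of the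
problem described in Proposition 5 … The uniqueness implies u′ = 1»), (1.67)–(1.69) p. 88, (1.112) p. 95, (1.36)–(1.38) p. 82, p. 77 («Ω_j = T_η»),
§3 p. 98.  T. Bałaban, *Propagators for lattice gauge theories in a background field*, CMP **99** (1985) 389–434
`[Balaban1985BackgroundPropagators]` ("[4]"): Thm 3.1 p. 397, (3.24)–(3.25) p. 394.  STATUS: published, refereed.

CITATION HEADER (lean-in-tree rule).  Cell `lit-balaban`, seat `lit-balaban-t2s-1` (gen 3), sub-row «G-B8-T2S» (R3 `stmt-QuantumFields-19200`,
`--supports`, helper), route P on the v3 letters.  WHAT IS PROVED (0 sorry, no `def`):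
* §0 `lam_per_of_gaugeExp` (a Hermitian `λ` with `|λ| < c_u ≤ ⅕` read through a `P`-periodic `e^{iλ}` is `P`-periodic: `log e^Z = Z`,
  `B7Eq170Flat.mlog_exp_of_le`), `AwH_per` (the hybrid weight operator `𝔄 ∘ π` of `B8Thm2TorusLettersPerConv` is level-periodic-valued at EVERY
  argument).
* §1 ★ **`sockP5uE_body_of_join_b_per`** — `B8SockP5uEAssemblyB.sockP5uE_body_of_join_b` (the provider body of the repaired Proposition-5 uniqueness
  socket: datum of Theorem 4's uniqueness paragraph, two competitors, guarded left inverse; `Ω 0 = ℤᵈ` sub-family) VERBATIM except (RULING #4): the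
  letters' (U1) `g_leftB` is read at PERIODIC bounded functions, (U2) `c_left'` at LEVEL-PERIODIC multipliers, (1.91) `hQH` at LEVEL-PERIODIC
  families; the torus data are displayed (`Lʲ ∣ P`, shift-invariant `Λ_j`, periodic `U₀`, `U′`, `u₁`; `G′` periodic-valued, `𝔄` level-periodic-valued,
  `H′` periodicity-preserving); the two competitors `v`, `w` are `P`-PERIODIC; engine = `B8Prop5UniqSectEWPer.hFP_unique_of_sectE_local_wb_per`.  The
  two inputs the per engine asks beyond the v2 body are DERIVED here: the masked exponent `A′ = (iη)⁻¹ log U₁` is periodic because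
  `U₁ = U′^{u₁⁻¹}` is (`B8Thm2TorusSupplier.mgauge_periodic`), and each competitor's Landau multiplier is replaced by its LEVEL-PERIODIC
  representative (`B8Thm2TorusServerPer.exists_levelPeriodic_multiplier`: the Landau letter `Δ(D*A) = Q′ᵀμ` has a periodic left side, and `Q′ᵀ` is
  block-local and translation covariant).
* §2 ★ **`sockP5Uniq_of_lettersAtPer`** — `B8Thm2TorusSupplier.SockP5Uniq L k P η c_A c_u G U₀ U′` at `c_A = 5dLB₀(α₀ + α₁′)` for ANY `α₁′`
  dominating the all-levels closeness (1.66), FROM THE v3 LETTERS `ℓ : LettersAtPer … k α₀ P U₀` read through the hybrid letters of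
  `B8Thm2TorusLettersPerConv` (`gH ∕ covLapₗ ∕ qH ∕ QTₗ ∕ AwH ∕ cH ∕ HH`: (U1)∕(U2)∕(1.91) at periodic arguments = `g_leftB_H ∕ c_left'_H ∕ hQH_H`, the
  bound∕reads laws at all arguments, remainder constant `B_R + 2`), the b9 socket at the top truncation and the uniqueness windows of
  `B8SockP5uEWindows.uniqWindows_of_guard` at `(2B₀, B_R + 2)` — the v3 twin of `B8Thm2TorusServerP3.sockP5Uniq_of_lettersAt`.

## HONEST SCOPE
(i) Compositions of landed theorems; Proposition 5 is NOT re-proved; the v3 letters, the b9 socket `SockB9P3` and the J-SU data are displayed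
hypotheses; windows explicit and merely sufficient.  (ii) The level-periodic-multiplier premise of the per engine is DISCHARGED here (not displayed).
(iii) `d ≥ 2`, `L ≥ 2`, `G ≤ U(𝔸)`, `𝔸` a C⋆-algebra, `P ∈ Lᵏℤ`.  Count-neutral; N05 ∕ `stub_PV3A` NOT discharged; Theorem 2 not claimed here; nothing
continuum ∕ ℝ⁴ ∕ OS ∕ mass-gap ∕ Clay — the Yang–Mills mass gap is NOT proved.  No `sorry`, no `def`, no `… : Prop` fact, no `instance`, no `notation`.
-/

noncomputable section

open NormedSpace
open scoped BigOperators

namespace Literature.MathematicalPhysics.QuantumFieldTheory.Balaban1983to89.B8Thm2TorusUniqPer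

open Complex (I)
open MatrixLog (mlog)
open B7Prop1Explicit B7Prop2Explicit B7Prop1Local B7Eq92Concrete
open B7Prop2Explicit (C0 c2')
open B7Prop3Flat (c3)
open B7Prop10General (C6 C4G)
open B7Prop9Flat (C5')
open B7Eq78Linearization (conjR zdBlocking QprimeIter)
open B7Eq167Flat (InLambda)
open B7Eq170Flat (mlog_exp_of_le)
open B8Ineq132 (covDerivFwd covDeriv InAk norm_conjR)
open B8Eq119TwistedAxial (Restr129 InAx bgT)
open B8Eq184Proof (gaugeExp cfgExp)
open B8Eq182Proof (gAd)
open B8Eq188Proof (frakF3)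
open B8Lemma1NonAbelian (mulCfg)
open B8Eq140Level (SideTouches sideTouches_mono)
open B8Eq146AExpansion (iEta expCfg)
open B8Ineq130 (tlo thi)
open B8Thm2LogB (blockTop)
open B8Eq138LandauZd (IsLandau138 IsLandau138W covDivB covLap QT logCfg)
open B8Ineq125Concrete (C2p)
open B8Eq1117Concrete (XSpace)
open B8Eq1117KLevel (glev_on_towers_of_axial)
open B8SectEInLambdaWitness (witness_unitary_of_glev)
open B8Prop3GaugeFixedKLevel (expCfg_iEta_eq_cfgExp logField_spec mem_unitaryUnits_of_mgauge_eq)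
open B8Eq155JBound (expCfg_iEta_mem_unitaryUnits)
open B8Thm4AtLandau138 (mgauge_mgauge_inv)
open B8Thm4Concrete (mulCfg_eq_mul)
open B8LeafModelZd3 (SockB9P3)
open B8Prop5ContractionKLevel (Bd2 Mc Kc)
open B8LambdaSpaceKLevel (wt wt_nonneg)
open B8Prop5GaugeParamKLevel (norm_covDeriv_eq)
open B8Prop5KLevelLetters (covDivB_logCfg_gaugeFixed)
open B8Prop5SocketDatum (exists_masked_datum grad_bound_of_datum bd2_covDivB_of_grad sideTouches_pair_of_mem sideTouches_of_tower_bond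
  h33_of_inAk hP_of_datum h69_of_datum hA_of_datum)
open B8Prop5UniqSectEWPer (hFP_unique_of_sectE_local_wb_per)
open B12Ineq417Flat (shiftCfg shiftCfg_apply)
open B8Prop5NeumannPeriodic (covDivB_per)
open B8TorusPeriodization (perzFam perzFam_per)
open B8Thm4TorusAt (torusLam mem_torusLam_iff)
open B8Thm2TorusMember (torusLamb mem_torusLamb_iff)
open B8Thm2TorusSupplier (SockP5Uniq mgauge_periodic)
open B8Thm2TorusLetters (torus_member_laws)
open B8Thm2TorusLettersPer (LettersAtPer)
open B8Thm2TorusLettersPerConv (covLapₗ QTₗ qH gH AwH cH HH AwH_apply covLap_per hΔ_H hqs_H hq_H hq0_H hH0_H hH1_H hH2_H hQH_H hG_H hRbd_H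
  g_leftB_H c_left'_H)
open B8SockHFPTorusTraceFreePer (gH_per HH_per)
open B8Thm2TorusServerP3 (torus_hclass)
open B8Thm2TorusServerPer (exists_levelPeriodic_multiplier gaugeExp_per)

-- `Site` alone could resolve to the torus sites of `Setup.lean`; re-export the `ℤ^d` sites of `B7Prop1Explicit`.
export B7Prop1Explicit (Site)

variable {d : ℕ} {𝔸 : Type*} [CStarAlgebra 𝔸] [Nontrivial 𝔸]

/-! ## §0 Periodicity bookkeeping -/

section Per

omit [Nontrivial 𝔸] in
/-- **A small Hermitian exponent read through a periodic `e^{iλ}` is periodic**: if `e^{iλ(x)} = v(x)` with `|λ(x)| < c_u ≤ ⅕` and `v` is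
`P`-periodic, then `λ` is `P`-periodic (`λ = −i·log e^{iλ}`, `B7Eq170Flat.mlog_exp_of_le`). [cite: Balaban1985RegularSpaces, Prop. 5 (1.107)–(1.109) p.94, p.77 («Ω_j = T_η»); Balaban1985Averaging, (21) p.21] -/
theorem lam_per_of_gaugeExp {P : ℤ} {v : Site d → 𝔸ˣ} {lam : Site d → 𝔸} {cu : ℝ} (hcu : cu ≤ 1 / 5)
    (hv : ∀ x, ((gaugeExp lam x : 𝔸ˣ) : 𝔸) = ((v x : 𝔸ˣ) : 𝔸) ∧ IsSelfAdjoint (lam x) ∧ ‖lam x‖ < cu)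
    (hvP : ∀ (x : Site d) (i : Fin d), v (x + P • e i) = v x) :
    ∀ (z : Site d) (i : Fin d), lam (z + P • e i) = lam z := by
  have key : ∀ y, lam y = (-I) • mlog ((v y : 𝔸ˣ) : 𝔸) := fun y => by
    have hn : ‖I • lam y‖ ≤ 1 / 5 := by
      rw [norm_smul, Complex.norm_I, one_mul]; exact ((hv y).2.2.le.trans hcu)
    rw [← (hv y).1, gaugeExp, val_expUnit, mlog_exp_of_le hn, smul_smul,
      show (-I : ℂ) * I = 1 by rw [neg_mul, Complex.I_mul_I, neg_neg], one_smul]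
  intro z i
  rw [key, key, hvP]

omit [Nontrivial 𝔸] in
/-- **The hybrid weight operator `𝔄 ∘ π` is level-periodic-valued at EVERY argument** ((P4) of `LettersAtPer` at the periodised family).
[cite: Balaban1985RegularSpaces, (1.95) p.92, p.77] -/
theorem AwH_per {L : ℕ} {BG BR B₀'H B₂' B₀ B₀β cB β : ℝ} {len : Site d → ℝ} {η : ℝ} {m : ℕ} {α₀ : ℝ} {P : ℤ} {U₀ : Site d → Fin d → 𝔸ˣ}
    (lt : LettersAtPer (𝔸 := 𝔸) L BG BR B₀'H B₂' B₀ B₀β cB β len η m α₀ P U₀) {n : ℕ} (hn : 1 ≤ n) (hnm : n ≤ m) :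
    ∀ μ : ℕ → Site d → 𝔸, ∀ j, j ≤ n → ∀ (y : Site d) (i : Fin d), AwH lt n μ j (y + (P / (L : ℤ) ^ j) • e i) = AwH lt n μ j y := by
  intro μ
  rw [AwH_apply]
  exact lt.aw_per n hn hnm (perzFam L P n μ) (perzFam_per L P n μ)

end Per

/-! ## §1 The provider body of the uniqueness socket at one datum, v3: (U1), (U2), (1.91) at periodic arguments, periodic competitors -/

/-- ★ **THE PROVIDER BODY OF THE PROPOSITION-5 UNIQUENESS SOCKET WITH THE [4] LETTERS' LAWS AT PERIODIC ARGUMENTS** (Prop. 5 (1.109) p. 94 used as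
on p. 95, on the torus §3 p. 98): `B8SockP5uEAssemblyB.sockP5uE_body_of_join_b` VERBATIM except — the member carries a period `P` with `Lʲ ∣ P` (`j ≤ k`),
shift-invariant constraint sets `Λ_j` and periodic `U₀`, `U′`, `u₁`; the letters' (U1) `g_leftB` holds at PERIODIC bounded functions, (U2) `c_left'` at
LEVEL-PERIODIC multipliers, (1.91) `hQH` at LEVEL-PERIODIC families, and `G′` is periodic-valued, `𝔄` level-periodic-valued, `H′` periodicity-preserving;
the two competitors `v`, `w` are `P`-periodic.  CLAIM: they coincide.  PROOF: the v2 datum dictionary verbatim (`B8Prop5SocketDatum`; the masked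
exponent `A′ = (iη)⁻¹ log U₁` is periodic with `U₁ = U′^{u₁⁻¹}`), each competitor's exponent is periodic (`lam_per_of_gaugeExp`) and its Landau
multiplier is replaced by the level-periodic representative (`B8Thm2TorusServerPer.exists_levelPeriodic_multiplier`), then the per engine
`B8Prop5UniqSectEWPer.hFP_unique_of_sectE_local_wb_per`.
[cite: Balaban1985RegularSpaces, Prop. 5 (1.109) p.94, Thm 4 p.88, p.95 (uniqueness paragraph), (1.67)–(1.69) p.88, (1.112) p.95, (1.38) p.82, §3 p.98; Balaban1985Averaging, (166)–(167) p.44; Balaban1985BackgroundPropagators, Thm 3.1 p.397, (3.24)–(3.25) p.394] -/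
theorem sockP5uE_body_of_join_b_per (hd2 : 2 ≤ d) {L : ℕ} (hL : 2 ≤ L) {η : ℝ} (hη : 0 < η) {k : ℕ} (hk : 1 ≤ k) (P : ℤ)
    -- the member's geometry (`Ω 0 = univ` sub-family)
    {Ω : ℕ → Set (Site d)} (hΩ : ∀ j, Ω (j + 1) ⊆ Ω j) (hΩ0 : Ω 0 = Set.univ) {Λs : ℕ → ℕ → Set (Site d)} {Λb : ℕ → ℕ → Set (Site d × Fin d)}
    (hbox : ∀ m, m ≤ k → ∀ j, j ≤ m → ∀ c ∈ Λb m j, ∀ x, InBox (loK L j c.1) (bondHiK L j c.1 c.2) x → x ∈ Ω j)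
    (hclass : ∀ m, m ≤ k → ∀ j, j ≤ m → ∀ c ∈ Λb m j,
      (c.1 ∈ Λs m j ∧ c.1 + e c.2 ∈ Λs m j) ∨
      (∃ j', j = j' + 1 ∧ (∀ x, (L : ℤ) • c.1 ≤ x → x ≤ (L : ℤ) • c.1 + blockTop L → x ∈ Λs m j') ∧ c.1 + e c.2 ∈ Λs m j) ∨
      (∃ j', j = j' + 1 ∧ c.1 ∈ Λs m j ∧ (∀ x, (L : ℤ) • (c.1 + e c.2) ≤ x → x ≤ (L : ℤ) • (c.1 + e c.2) + blockTop L → x ∈ Λs m j')))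
    (htower : ∀ j, j ≤ k → ∀ y ∈ Λs k j, ∀ x, InBox (tlo L y j) (thi L y j) x → x ∈ Ω j)
    -- the torus: `Lʲ ∣ P`, shift-invariant `Λ_j`, periodic data
    (hdiv : ∀ j, j ≤ k → ((L : ℤ) ^ j ∣ P))
    (hΛ : ∀ j, j ≤ k → ∀ (y : Site d) (i : Fin d), y + (P / (L : ℤ) ^ j) • e i ∈ Λs k j ↔ y ∈ Λs k j)
    -- the socket's antecedents: constants, (1.33), (1.34), (1.35)
    {α₀ α₁ B₀ cs α₄ cu : ℝ} (hα₀ : 0 < α₀) (hα₁ : 0 < α₁) (hB₀ : 0 < B₀)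
    (hcs : cs = 5 * (d : ℝ) * L * B₀ * (α₀ + α₁)) (hα₄ : 0 < α₄)
    {U₀ U' : Site d → Fin d → 𝔸ˣ} (hU₀ : ∀ x κ, U₀ x κ ∈ unitaryUnits 𝔸) (hU' : ∀ x κ, U' x κ ∈ unitaryUnits 𝔸)
    (hU₀per : ∀ (z : Site d) (i : Fin d), U₀ (z + P • e i) = U₀ z) (hU'per : ∀ (z : Site d) (i : Fin d), U' (z + P • e i) = U' z)
    (h33 : InAk L k η α₀ Ω U₀) (h34 : InAk L k η α₀ Ω (mulCfg U' U₀)) (hAx : ∀ m', m' ≤ k → InAx L m' (Λs m') U₀ (mulCfg U' U₀))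
    (h135 : ∀ j, j ≤ k → ∀ (z : Site d) (μ : Fin d), (∀ x, InBox (loK L j z) (bondHiK L j z μ) x → x ∈ Ω j) →
      ‖(avgIter L (mulCfg U' U₀) j z μ : 𝔸) - (avgIter L U₀ j z μ : 𝔸)‖ ≤ α₁)
    -- the datum of Theorem 4's uniqueness paragraph: `u₁` periodic with (1.29), (1.38) and the (1.62)-shape for `U₁ = U′^{u₁⁻¹}`
    {u₁ : Site d → 𝔸ˣ} (hu₁ : ∀ x, u₁ x ∈ unitaryUnits 𝔸) (hu₁per : ∀ (z : Site d) (i : Fin d), u₁ (z + P • e i) = u₁ z)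
    (h129 : Restr129 L k (Λs k) U₀ u₁)
    (hLan : IsLandau138W L k η (Ω 0) (Λs k) U₀ (mgauge U₀ u₁⁻¹ U'))
    (hdat : ∃ A₁ : Site d → Fin d → 𝔸, ∀ j, j ≤ k → ∀ (x : Site d) (κ : Fin d), SideTouches (Ω j) x κ →
      mgauge U₀ u₁⁻¹ U' x κ = cfgExp η A₁ x κ ∧ ‖A₁ x κ‖ ≤ cs * ((L : ℝ) ^ j * η)⁻¹)
    -- the b9 socket in Proposition 3's frame AT THE TOP LEVEL `k`, and its threshold
    {B₀β cB9 β : ℝ} {len : Site d → ℝ} (SB9 : SockB9P3 (𝔸 := 𝔸) L B₀ B₀β cB9 β len η k Ω Λs Λb)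
    (hα₀9 : α₀ ≤ cB9) (hcs9 : cs ≤ cB9)
    -- Proposition 3's windows at `(α₀, α₂ := c⋆)` not implied by the JOIN's
    {C₂ : ℝ} (hside : 36 * d * B₀ * cs ≤ 1 / 2)
    (hC₂ : 8 * (131072 * ((d : ℝ) + 1) ^ 2) * Real.exp (4 * (800 * ((d : ℝ) + 1) ^ 2 * ((d : ℝ) + 4)) * α₀) ≤ C₂)
    (h61 : 2 * cs ^ 2 + 20 * d * α₀ * cs + 2 * C₂ * cs ^ 2 ≤ α₀ + α₁) (hsmall₁ : (d : ℝ) * L * α₁ ≤ 1 / 8)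
    -- the [4] LETTERS at `(k, U₀)`, with the uniqueness laws AT PERIODIC ARGUMENTS and the periodicity-preservation laws
    (g Δ : (Site d → 𝔸) →ₗ[ℂ] (Site d → 𝔸)) (q : (Site d → 𝔸) →ₗ[ℂ] (ℕ → Site d → 𝔸)) (qs : (ℕ → Site d → 𝔸) →ₗ[ℂ] (Site d → 𝔸))
    (Aw c : (ℕ → Site d → 𝔸) →ₗ[ℂ] (ℕ → Site d → 𝔸))
    (g_leftB : ∀ x : Site d → 𝔸, (∀ (z : Site d) (i : Fin d), x (z + P • e i) = x z) → (∃ C : ℝ, ∀ y, ‖x y‖ ≤ C) →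
      g (Δ x + qs (Aw (q x))) = x)
    (c_left' : ∀ φ : ℕ → Site d → 𝔸, (∀ j, j ≤ k → ∀ (y : Site d) (i : Fin d), φ j (y + (P / (L : ℤ) ^ j) • e i) = φ j y) →
      qs (c (q (g (g (qs φ))))) = qs φ)
    (hΔ : ∀ (f : Site d → 𝔸), ∀ x ∈ Ω 0, Δ f x = covLap η U₀ ((Ω 0).indicator f) x)
    (hqs : ∀ (μ : ℕ → Site d → 𝔸), ∀ x ∈ Ω 0, qs μ x = QT L k (Λs k) U₀ μ x)
    (hq : ∀ (f : Site d → 𝔸) (j : ℕ), j ≤ k → ∀ y ∈ Λs k j, q f j y = QprimeIter (zdBlocking d L) (bgT L U₀) j f y)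
    (hq0 : ∀ (f : Site d → 𝔸) (j : ℕ) (y : Site d), ¬ (j ≤ k ∧ y ∈ Λs k j) → q f j y = 0)
    (hGper : ∀ (f : Site d → 𝔸) (z : Site d) (i : Fin d), g f (z + P • e i) = g f z)
    (hAw_per : ∀ μ : ℕ → Site d → 𝔸, (∀ j, j ≤ k → ∀ (y : Site d) (i : Fin d), Aw μ j (y + (P / (L : ℤ) ^ j) • e i) = Aw μ j y))
    (H' : XSpace d k 𝔸 →ₗ[ℂ] (Site d → 𝔸)) {B₀'H B₂' BG BR : ℝ} (hB₀'H : 0 < B₀'H) (hB₂' : 0 ≤ B₂') (hBG : 0 ≤ BG) (hBR : 0 ≤ BR)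
    (hH0 : ∀ (X : XSpace d k 𝔸) (x : Site d), ‖H' X x‖ ≤ B₀'H * ‖X‖)
    (hH1 : ∀ j, j ≤ k → ∀ (X : XSpace d k 𝔸), ∀ p ∈ {b : Site d × Fin d | SideTouches (Ω j) b.1 b.2},
      wt L η j * ‖covDerivFwd η U₀ p.2 (H' X) p.1‖ ≤ B₀'H * ‖X‖)
    (hH2 : ∀ X : XSpace d k 𝔸, Bd2 L η k Ω (covLap η U₀ (H' X)) (B₂' * ‖X‖))
    (hHper : ∀ X : XSpace d k 𝔸, (∀ (p : Fin (k + 1) × Site d) (i : Fin d), X (p.1, p.2 + (P / (L : ℤ) ^ (p.1 : ℕ)) • e i) = X p) →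
      ∀ (z : Site d) (i : Fin d), H' X (z + P • e i) = H' X z)
    (hQH : ∀ (Y : XSpace d k 𝔸), (∀ (p : Fin (k + 1) × Site d) (i : Fin d), Y (p.1, p.2 + (P / (L : ℤ) ^ (p.1 : ℕ)) • e i) = Y p) →
      ∀ (j : ℕ) (hj : j ≤ k) (y : Site d), y ∈ Λs k j →
      QprimeIter (zdBlocking d L) (bgT L U₀) j (H' Y) y = Y (⟨j, Nat.lt_succ_of_le hj⟩, y))
    (hG : ∀ (f : Site d → 𝔸) (r : ℝ), 0 ≤ r → Bd2 L η k Ω f r →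
      (∀ x, ‖g f x‖ ≤ BG * r) ∧ ∀ j, j ≤ k → ∀ p ∈ {b : Site d × Fin d | SideTouches (Ω j) b.1 b.2},
        wt L η j * ‖covDerivFwd η U₀ p.2 (g f) p.1‖ ≤ BG * r)
    (hRbd : ∀ (f : Site d → 𝔸) (r : ℝ), 0 ≤ r → Bd2 L η k Ω f r → Bd2 L η k Ω (f - g (qs (c (q (g f))))) (BR * r))
    -- the JOIN's scalar windows, one-for-one (`αP := α₀`, `α₄` free; `cB cA cDA` free above their datum values)
    {cB cA cDA : ℝ} (hcBlo : L * cs ≤ cB) (hcAlo : L * cs ≤ cA) (hcDAlo : (d : ℝ) * (L : ℝ) ^ 2 * cs ≤ cDA)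
    (hα3 : C0 d * α₀ ≤ 1 / 3) (hα4 : 4 * α₀ ≤ c2' d L)
    (hsmall : Real.exp (4 * (800 * ((d : ℝ) + 1) ^ 2 * ((d : ℝ) + 4)) * α₀) * (1 + 8 * (131072 * ((d : ℝ) + 1) ^ 2) * cB) ≤ 2)
    (hc₃ : 2 * cB ≤ c3 d L) (hsc : 2048 * (d : ℝ) * cB ≤ 1) (hα₃' : 40 * d * cB ≤ 1 / 200)
    (hs₁ : 200 * C6 d * (2 * α₄) ≤ 1) (hs₂ : 12000 * ((d : ℝ) + 1) * L * (2 * α₄) ≤ 1)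
    (hs₃ : C4G d L * (α₀ + 40 * d * cB + 4 * (2 * α₄)) ≤ 1)
    (hs₄ : 1024 * ((d : ℝ) + 1) * ((d : ℝ) + 4) * L ^ 2 * α₀ ≤ 1) (hs₅ : 32 * ((d : ℝ) + 1) ^ 2 * C6 d * L ^ 2 * α₀ ≤ 1)
    (hs₆ : 16 * d * C5' d * C6 d * (L : ℝ) ^ 2 * α₀ ≤ 1) (hs₇ : 8 * d * C6 d * L * α₀ ≤ 1)
    (hsm : 40 * d * cB + α₄ ≤ 1 / (4 * B₀'H * (2 * C2p d))) (hprod8 : 2 * C6 d * (40 * d * cB + 4 * α₄) ≤ 1 / 8)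
    {hE hE₂ lE lE₂ : ℝ} (hE_def : hE = B₀'H * (C2p d * (40 * d * cB + α₄) * α₄)) (hE₂_def : hE₂ = B₂' * (C2p d * (40 * d * cB + α₄) * α₄))
    (lE_def : lE = B₀'H * (4 * C2p d * (40 * d * cB + 2 * α₄))) (lE₂_def : lE₂ = B₂' * (4 * C2p d * (40 * d * cB + 2 * α₄)))
    (hcA' : cA ≤ 1 / 13) (ha₁' : α₄ / 4 + hE ≤ 1 / 24) (hb₁' : α₄ / 4 + hE ≤ 1 / 140) (hθ : 10 * (α₄ / 4 + hE) * BR ≤ 1 / 2)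
    (h103 : BG * Mc d BR (α₄ / 4 + hE) cA hE₂ cDA ≤ α₄ / 4)
    (h106 : BG * Kc d BR (α₄ / 4 + hE) cA hE₂ cDA lE₂ (1 + lE) (1 + lE) ≤ 1 / 2)
    -- the two uniqueness windows: Lipschitz modulus of `H_c`, and the radius `c_u` of (1.109) against the ¼α₄-ball
    (hlE : lE ≤ 1 / 2) (hcu : cu + hE ≤ α₄ / 4)
    -- the competitors, PERIODIC
    {v w : Site d → 𝔸ˣ} {lam mu : Site d → 𝔸}
    (hvP : ∀ (x : Site d) (i : Fin d), v (x + P • e i) = v x) (hwP : ∀ (x : Site d) (i : Fin d), w (x + P • e i) = w x)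
    (hv : ∀ x, ((gaugeExp lam x : 𝔸ˣ) : 𝔸) = ((v x : 𝔸ˣ) : 𝔸) ∧ IsSelfAdjoint (lam x) ∧ ‖lam x‖ < cu)
    (hvD : ∀ j, j ≤ k → ∀ b ∈ {b : Site d × Fin d | SideTouches (Ω j) b.1 b.2}, ((L : ℝ) ^ j * η) * ‖covDerivFwd η U₀ b.2 lam b.1‖ < cu)
    (hw : ∀ x, ((gaugeExp mu x : 𝔸ˣ) : 𝔸) = ((w x : 𝔸ˣ) : 𝔸) ∧ IsSelfAdjoint (mu x) ∧ ‖mu x‖ < cu)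
    (hwD : ∀ j, j ≤ k → ∀ b ∈ {b : Site d × Fin d | SideTouches (Ω j) b.1 b.2}, ((L : ℝ) ^ j * η) * ‖covDerivFwd η U₀ b.2 mu b.1‖ < cu)
    (hLv : IsLandau138W L k η (Ω 0) (Λs k) U₀ (mgauge U₀ v⁻¹ (mgauge U₀ u₁⁻¹ U'))) (hRv : Restr129 L k (Λs k) U₀ (u₁ * v))
    (hLw : IsLandau138W L k η (Ω 0) (Λs k) U₀ (mgauge U₀ w⁻¹ (mgauge U₀ u₁⁻¹ U'))) (hRw : Restr129 L k (Λs k) U₀ (u₁ * w)) :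
    ∀ x, v x = w x := by
  subst hcs
  have hL1 : 1 ≤ L := le_trans (by norm_num) hL
  have hd1 : 1 ≤ d := le_trans (by norm_num) hd2
  have hLr : (1 : ℝ) ≤ L := by exact_mod_cast hL1
  have hd0 : (1 : ℝ) ≤ d := by exact_mod_cast hd1
  have huniv : ∀ x, x ∈ Ω 0 := fun x => by rw [hΩ0]; exact Set.mem_univ x
  obtain ⟨k', rfl⟩ : ∃ k', k = k' + 1 := ⟨k - 1, (Nat.sub_add_cancel hk).symm⟩
  have hsum : 0 < α₀ + α₁ := add_pos hα₀ hα₁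
  have hcs0 : 0 ≤ 5 * (d : ℝ) * L * B₀ * (α₀ + α₁) := by positivity
  have hcspos : 0 < 5 * (d : ℝ) * L * B₀ * (α₀ + α₁) := by positivity
  have hα₄pos : 0 < α₄ := hα₄
  -- `c⋆ ≤ L·c⋆ ≤ cB`, hence Prop. 3's remaining windows from the JOIN's
  have hcsB : 5 * (d : ℝ) * L * B₀ * (α₀ + α₁) ≤ cB := (le_mul_of_one_le_left hcs0 hLr).trans hcBlo
  have hcB0 : 0 ≤ cB := hcs0.trans hcsB
  have hcA0 : 0 ≤ cA := (hcs0.trans (le_mul_of_one_le_left hcs0 hLr)).trans hcAlo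
  have hcDA0 : 0 ≤ cDA := le_trans (by positivity) hcDAlo
  have hcBsmall : (d : ℝ) * cB ≤ 1 / 8000 := by linarith only [hα₃']
  have hdcs : (d : ℝ) * (5 * (d : ℝ) * L * B₀ * (α₀ + α₁)) ≤ 1 / 8000 :=
    (mul_le_mul_of_nonneg_left hcsB (by positivity)).trans hcBsmall
  have hcs8000 : 5 * (d : ℝ) * L * B₀ * (α₀ + α₁) ≤ 1 / 8000 := (le_mul_of_one_le_left hcs0 hd0).trans hdcs
  have h16 : 16 * (5 * (d : ℝ) * L * B₀ * (α₀ + α₁)) ≤ 1 := by linarith only [hcs8000]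
  have h50 : 50 * d * (5 * (d : ℝ) * L * B₀ * (α₀ + α₁)) ≤ 1 := by linarith only [hdcs]
  have hd5 : 5 * (5 * (d : ℝ) * L * B₀ * (α₀ + α₁)) * ((d : ℝ) - 1) ≤ 4 := by nlinarith only [hdcs, hcs0]
  have hc₃3 : 2 * (5 * (d : ℝ) * L * B₀ * (α₀ + α₁)) ≤ c3 d L := by linarith only [hc₃, hcsB]
  have hsmall3 : Real.exp (4 * (800 * ((d : ℝ) + 1) ^ 2 * ((d : ℝ) + 4)) * α₀) *
      (1 + 8 * (131072 * ((d : ℝ) + 1) ^ 2) * (5 * (d : ℝ) * L * B₀ * (α₀ + α₁))) ≤ 2 := by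
    refine le_trans (mul_le_mul_of_nonneg_left ?_ (Real.exp_pos _).le) hsmall
    have h := mul_le_mul_of_nonneg_left hcsB (show (0 : ℝ) ≤ 8 * (131072 * ((d : ℝ) + 1) ^ 2) by positivity)
    linarith only [h]
  have hαP2 : 2 * α₀ ≤ c2' d L := by linarith only [hα4, hα₀]
  have hC2 : 0 ≤ C2p d := B8Ineq125Concrete.C2p_nonneg d
  have hhE : 0 ≤ hE := by rw [hE_def]; positivity
  -- the datum `U₁ = U′^{u₁⁻¹}`: unitary, periodic, `U₁^{u₁} = U′`, and its Hermitian logarithm on the touched bonds ((1.62)-shape ⇒ `logField_spec`)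
  set U₁ : Site d → Fin d → 𝔸ˣ := mgauge U₀ u₁⁻¹ U' with hU₁def
  have hW : mgauge U₀ u₁ U₁ = U' := mgauge_mgauge_inv U₀ U' u₁
  have hWu : ∀ x κ, U₁ x κ ∈ unitaryUnits 𝔸 := mem_unitaryUnits_of_mgauge_eq hU₀ hU' hu₁ hW
  have hU₁P : ∀ (z : Site d) (i : Fin d), U₁ (z + P • e i) = U₁ z := fun z i => funext fun κ =>
    mgauge_periodic (p := P • e i) (fun x κ => by rw [hU₀per x i]) (fun x κ => by rw [hU'per x i])
      (fun x => by rw [Pi.inv_apply, Pi.inv_apply, hu₁per x i]) z κ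
  obtain ⟨A₁, hA₁⟩ := hdat
  have hdat' : ∀ j, j ≤ k' + 1 → ∀ b ∈ {b : Site d × Fin d | SideTouches (Ω j) b.1 b.2},
      U₁ b.1 b.2 = cfgExp η (logCfg η U₁) b.1 b.2 ∧ IsSelfAdjoint (logCfg η U₁ b.1 b.2) ∧
        ‖logCfg η U₁ b.1 b.2‖ ≤ (5 * (d : ℝ) * L * B₀ * (α₀ + α₁)) * ((L : ℝ) ^ j * η)⁻¹ := by
    intro j hj b hb
    obtain ⟨hexp, hbd⟩ := hA₁ j hj b.1 b.2 hb
    have hbd' : ‖A₁ b.1 b.2‖ ≤ (5 * (d : ℝ) * L * B₀ * (α₀ + α₁)) * η⁻¹ := by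
      refine hbd.trans ?_
      have hLj : (1 : ℝ) ≤ (L : ℝ) ^ j := one_le_pow₀ hLr
      have : ((L : ℝ) ^ j * η)⁻¹ ≤ η⁻¹ := by
        rw [mul_inv]
        calc ((L : ℝ) ^ j)⁻¹ * η⁻¹ ≤ 1 * η⁻¹ := by gcongr; exact inv_le_one_of_one_le₀ hLj
          _ = η⁻¹ := one_mul _
      exact mul_le_mul_of_nonneg_left this hcs0
    obtain ⟨hlogA, hsa, hWexp⟩ := logField_spec hη U₀ hWu hexp hbd' (by linarith only [h16])
    refine ⟨hWexp, ?_, ?_⟩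
    · simpa [logCfg] using hsa
    · show ‖logCfg η U₁ b.1 b.2‖ ≤ _
      rw [logCfg, hlogA]
      exact hbd
  -- the MASKED exponent `A′` (globally Hermitian); at `Ω 0 = univ` every bond is touched, so `U₁ = e^{iηA′}` GLOBALLY and `A′` is periodic
  obtain ⟨A', hsa, hA'eq, hWA, hA0⟩ := exists_masked_datum hdat'
  have hWA1 : ∀ j, j ≤ k' → ∀ (y : Site d) (τ : Fin d), SideTouches (Ω j) y τ → U₁ y τ = cfgExp η A' y τ :=
    fun j hj y τ hs => (hWA j (Nat.le_succ_of_le hj) y τ hs).1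
  have h41 : ∀ j, j ≤ k' → ∀ (y : Site d) (τ : Fin d), SideTouches (Ω j) y τ →
      ‖A' y τ‖ ≤ (5 * (d : ℝ) * L * B₀ * (α₀ + α₁)) * ((L : ℝ) ^ j * η)⁻¹ := fun j hj y τ hs => (hWA j (Nat.le_succ_of_le hj) y τ hs).2
  have htouch0 : ∀ (y : Site d) (τ : Fin d), SideTouches (Ω 0) y τ := fun y τ => (sideTouches_pair_of_mem hd2 (huniv y) τ).1
  have hU₁eq : U₁ = cfgExp η A' := funext fun y => funext fun τ => (hWA 0 (Nat.zero_le _) y τ (htouch0 y τ)).1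
  have hA'0 : ∀ (y : Site d) (τ : Fin d), ‖A' y τ‖ ≤ (5 * (d : ℝ) * L * B₀ * (α₀ + α₁)) * η⁻¹ := fun y τ => by
    have h := (hWA 0 (Nat.zero_le _) y τ (htouch0 y τ)).2
    rwa [pow_zero, one_mul] at h
  have hA'per : ∀ (z : Site d) (i : Fin d), A' (z + P • e i) = A' z := fun z i => funext fun τ => by
    rw [hA'eq 0 (Nat.zero_le _) _ τ (htouch0 _ τ), hA'eq 0 (Nat.zero_le _) z τ (htouch0 z τ), logCfg, logCfg, hU₁P z i]
  -- the JOIN's datum binders BY NAME (`B8Prop5SocketDatum` §7, §3–§4)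
  have h33' := h33_of_inAk hL1 hα₀ h33 le_rfl htower
  have hP' := hP_of_datum hL1 hα₀ hΩ h34 le_rfl htower hu₁ hW hWA1
  have h69' : ∀ j, j ≤ k' + 1 → ∀ y ∈ Λs (k' + 1) j, ∀ (x : Site d) (κ : Fin d), InBox (tlo L y j) (thi L y j) x →
      InBox (tlo L y j) (thi L y j) (x + e κ) → ‖iEta η A' x κ‖ ≤ cB * ((L : ℝ) ^ j)⁻¹ :=
    fun j hj y hy x κ hx hxe =>
      (h69_of_datum hd2 hL1 hη hΩ htower hcs0 h41 j hj y hy x κ hx hxe).trans (mul_le_mul_of_nonneg_right hcBlo (by positivity))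
  have hAd : ∀ j, j ≤ k' + 1 → ∀ x ∈ Ω j, ∀ μ : Fin d,
      wt L η j * ‖A' x μ‖ ≤ cA ∧ wt L η j * ‖conjR (U₀ (x - e μ) μ)⁻¹ (A' (x - e μ) μ)‖ ≤ cA := fun j hj x hx μ =>
    ⟨(hA_of_datum hd2 hL1 hη hΩ hU₀ hcs0 h41 j hj x hx μ).1.trans hcAlo, (hA_of_datum hd2 hL1 hη hΩ hU₀ hcs0 h41 j hj x hx μ).2.trans hcAlo⟩
  have hBu : ∀ (x : Site d) (κ : Fin d), expCfg (iEta η A') x κ ∈ unitaryUnits 𝔸 := expCfg_iEta_mem_unitaryUnits η hsa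
  have hexpA : expCfg (iEta η A') = U₁ := by rw [expCfg_iEta_eq_cfgExp, hU₁eq]
  have hAx' : InAx L (k' + 1) (Λs (k' + 1)) U₀ (mgauge U₀ u₁ (expCfg (iEta η A')) * U₀) := by
    rw [hexpA, hW, ← mulCfg_eq_mul]
    exact hAx (k' + 1) le_rfl
  -- the source `D*A′`: (1.69)'s gradient member by Prop. 3 at the top level (§3), then `|D*A′|₍₋₂₎ ≤ d·L²·c⋆ ≤ cDA` (§4)
  have hgrad := grad_bound_of_datum hd2 hη hL (k' + 1) hU₀ hU' hα₀ hα₁ hcspos hB₀.le hα3 hα4 h16 hd5 hsmall3 hc₃3 hside h50 hC₂ h61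
    hsmall₁ Ω hΩ Λs Λb hbox hclass h33 h34 hAx h135 hk le_rfl SB9 hα₀9 hcs9 hu₁ hW h129 hLan hsa hWA hA0
  have hDA : Bd2 L η (k' + 1) Ω (fun y => covDivB η U₀ A' y) cDA := fun j hj x hx =>
    (bd2_covDivB_of_grad hd2 hL1 hη hΩ hU₀ hcs0 (fun j hj y κ τ hs => hgrad j (Nat.le_succ_of_le hj) y κ τ hs) j hj x hx).trans hcDAlo
  -- the JOIN's bond classes `Eb j := {b ∣ SideTouches (Ω j) b}` (§6)
  have hEbΩ : ∀ j, j ≤ k' + 1 → ∀ x ∈ Ω j, ∀ μ : Fin d, (x, μ) ∈ {b : Site d × Fin d | SideTouches (Ω j) b.1 b.2} ∧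
      (x - e μ, μ) ∈ {b : Site d × Fin d | SideTouches (Ω j) b.1 b.2} := fun j _ x hx μ => sideTouches_pair_of_mem hd2 hx μ
  have hEbT : ∀ j, j ≤ k' + 1 → ∀ y ∈ Λs (k' + 1) j, ∀ (x : Site d) (κ : Fin d), InBox (tlo L y j) (thi L y j) x →
      InBox (tlo L y j) (thi L y j) (x + e κ) → (x, κ) ∈ {b : Site d × Fin d | SideTouches (Ω j) b.1 b.2} :=
    fun j hj y hy x κ hx _ => sideTouches_of_tower_bond hd2 htower hj hy x κ hx
  -- each competitor: `v = e^{iλ}` globally with `λ` periodic; its (1.38) of record is the multiplier clause of `HFP` at `A′` by the D*-identity,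
  -- with a LEVEL-PERIODIC multiplier (the left side is periodic; `Q′ᵀ` is block-local and translation covariant)
  have hcu4 : cu ≤ α₄ / 4 := by linarith only [hcu, hhE]
  have hcu12 : cu ≤ 1 / 12 := by linarith only [hcu4, ha₁', hhE]
  have hcu70 : cu ≤ 1 / 70 := by linarith only [hcu4, hb₁', hhE]
  have hcomp : ∀ (vv : Site d → 𝔸ˣ) (ll : Site d → 𝔸), (∀ (x : Site d) (i : Fin d), vv (x + P • e i) = vv x) →
      (∀ x, ((gaugeExp ll x : 𝔸ˣ) : 𝔸) = ((vv x : 𝔸ˣ) : 𝔸) ∧ IsSelfAdjoint (ll x) ∧ ‖ll x‖ < cu) →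
      (∀ j, j ≤ k' + 1 → ∀ b ∈ {b : Site d × Fin d | SideTouches (Ω j) b.1 b.2}, ((L : ℝ) ^ j * η) * ‖covDerivFwd η U₀ b.2 ll b.1‖ < cu) →
      IsLandau138W L (k' + 1) η (Ω 0) (Λs (k' + 1)) U₀ (mgauge U₀ vv⁻¹ (mgauge U₀ u₁⁻¹ U')) →
      vv = gaugeExp ll ∧ (∀ (z : Site d) (i : Fin d), ll (z + P • e i) = ll z) ∧ (∀ x, ‖ll x‖ ≤ cu) ∧
      (∀ j, j ≤ k' + 1 → ∀ p ∈ {b : Site d × Fin d | SideTouches (Ω j) b.1 b.2}, wt L η j * ‖covDerivFwd η U₀ p.2 ll p.1‖ ≤ cu) ∧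
      (∃ μ : ℕ → Site d → 𝔸, (∀ j, j ≤ k' + 1 → ∀ (y : Site d) (i : Fin d), μ j (y + (P / (L : ℤ) ^ j) • e i) = μ j y) ∧ ∀ x ∈ Ω 0,
        covLap η U₀ ((Ω 0).indicator fun y => covDivB η U₀ A' y + covLap η U₀ ll y +
          ((conjR (gaugeExp ll y)⁻¹ (covDivB η U₀ A' y) - covDivB η U₀ A' y) +
            (gAd (covLap η U₀ ll y) (ll y) - covLap η U₀ ll y) + ∑ μ, frakF3 η U₀ ll A' y μ)) x = QT L (k' + 1) (Λs (k' + 1)) U₀ μ x) := by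
    intro vv ll hvvP hll hllD hL138
    have hveq : vv = gaugeExp ll := funext fun x => (Units.ext (hll x).1).symm
    have hllP : ∀ (z : Site d) (i : Fin d), ll (z + P • e i) = ll z := lam_per_of_gaugeExp (hcu12.trans (by norm_num)) hll hvvP
    refine ⟨hveq, hllP, fun x => (hll x).2.2.le, fun j hj p hp => (hllD j hj p hp).le, ?_⟩
    -- the Landau condition of record for `U₁^{v⁻¹} = (e^{iηA′})^{(e^{iλ})⁻¹}`, rewritten by the D*-identity on `Ω₀`
    have hL' : IsLandau138W L (k' + 1) η (Ω 0) (Λs (k' + 1)) U₀ (mgauge U₀ (gaugeExp ll)⁻¹ (cfgExp η A')) := by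
      rw [← hveq, ← hU₁eq]; exact hL138
    obtain ⟨μ, hμ⟩ := hL'
    -- the left side is `P`-periodic: a level-periodic representative of the multiplier
    set W : Site d → Fin d → 𝔸ˣ := mgauge U₀ (gaugeExp ll)⁻¹ (cfgExp η A') with hWdef
    have hWP : ∀ (z : Site d) (i : Fin d), W (z + P • e i) = W z := fun z i => funext fun κ =>
      mgauge_periodic (p := P • e i) (fun x κ => by rw [hU₀per x i])
        (fun x κ => by show cfgExp η A' (x + P • e i) κ = cfgExp η A' x κ; unfold cfgExp; rw [hA'per x i])
        (fun x => by rw [Pi.inv_apply, Pi.inv_apply, gaugeExp_per hllP x i]) z κ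
    have hlogP : ∀ (z : Site d) (i : Fin d), logCfg η W (z + P • e i) = logCfg η W z := fun z i => funext fun κ => by
      show logCfg η W (z + P • e i) κ = logCfg η W z κ
      unfold logCfg; rw [hWP z i]
    have hFP : ∀ (z : Site d) (i : Fin d),
        covLap η U₀ ((Ω 0).indicator (covDivB η U₀ (logCfg η W))) (z + P • e i) = covLap η U₀ ((Ω 0).indicator (covDivB η U₀ (logCfg η W))) z := by
      rw [hΩ0, Set.indicator_univ]
      exact covLap_per hU₀per (covDivB_per hU₀per hlogP)
    obtain ⟨μ', hμ'per, hμ'⟩ := exists_levelPeriodic_multiplier hL1 (k' + 1) hdiv hΛ hU₀per hFP (fun x => hμ x (huniv x))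
    refine ⟨μ', hμ'per, fun x hx => ?_⟩
    have hind : ((Ω 0).indicator fun y => covDivB η U₀ A' y + covLap η U₀ ll y +
        ((conjR (gaugeExp ll y)⁻¹ (covDivB η U₀ A' y) - covDivB η U₀ A' y) +
          (gAd (covLap η U₀ ll y) (ll y) - covLap η U₀ ll y) + ∑ μ, frakF3 η U₀ ll A' y μ)) =
        (Ω 0).indicator (covDivB η U₀ (logCfg η (mgauge U₀ (gaugeExp ll)⁻¹ (cfgExp η A')))) := by
      refine Set.indicator_congr fun y _ => ?_
      have hly : ‖ll y‖ ≤ 1 / 12 := (hll y).2.2.le.trans hcu12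
      have hDy : ∀ ν : Fin d, η * ‖covDerivFwd η U₀ ν ll y‖ ≤ 1 / 70 := fun ν => by
        have h := (hllD 0 (Nat.zero_le _) (y, ν) (htouch0 y ν)).le
        rw [pow_zero, one_mul] at h
        exact h.trans hcu70
      have hay : ∀ ν : Fin d, η * ‖covDeriv η U₀ ν ll y‖ ≤ 1 / 70 := fun ν => by
        rw [norm_covDeriv_eq hU₀]
        have h := (hllD 0 (Nat.zero_le _) (y - e ν, ν) (htouch0 (y - e ν) ν)).le
        rw [pow_zero, one_mul] at h
        exact h.trans hcu70
      have hYy : ∀ ν : Fin d, η * ‖conjR (U₀ (y - e ν) ν)⁻¹ (A' (y - e ν) ν)‖ ≤ 1 / 12 := fun ν => by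
        have hu : ((U₀ (y - e ν) ν)⁻¹ : 𝔸ˣ) ∈ U1 𝔸 := (U1 𝔸).inv_mem (unitaryUnits_le_U1 (hU₀ _ ν))
        rw [norm_conjR hu]
        calc η * ‖A' (y - e ν) ν‖ ≤ η * ((5 * (d : ℝ) * L * B₀ * (α₀ + α₁)) * η⁻¹) := mul_le_mul_of_nonneg_left (hA'0 _ ν) hη.le
          _ = 5 * (d : ℝ) * L * B₀ * (α₀ + α₁) := by field_simp
          _ ≤ 1 / 12 := by linarith only [h16]
      exact (covDivB_logCfg_gaugeFixed hη U₀ A' hly hDy hay hYy).symm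
    rw [hind]
    exact hμ' x
  obtain ⟨hveq, hlP, hl₁, hD₁, hmult₁⟩ := hcomp v lam hvP hv hvD hLv
  obtain ⟨hweq, hmP, hl₂, hD₂, hmult₂⟩ := hcomp w mu hwP hw hwD hLw
  have hR₁ : Restr129 L (k' + 1) (Λs (k' + 1)) U₀ (u₁ * gaugeExp lam) := by rw [← hveq]; exact hRv
  have hR₂ : Restr129 L (k' + 1) (Λs (k' + 1)) U₀ (u₁ * gaugeExp mu) := by rw [← hweq]; exact hRw
  -- unitary Λ_j-witnesses for `u₁` (Theorem 4's inductive gauge transformation) at class constant `40d·c_B`, from (1.34), (1.29)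
  have hα₃0 : (0 : ℝ) ≤ 40 * d * cB := by positivity
  have hwit : ∀ j, j ≤ k' + 1 → ∀ y ∈ Λs (k' + 1) j, ∃ ut : Site d → 𝔸ˣ, (∀ x, ut x ∈ unitaryUnits 𝔸) ∧
      InLambda L (clampCfg (tlo L y j) (thi L y j) U₀) ut j (40 * d * cB) (((L : ℝ) ^ j)⁻¹) ∧
      ∀ x : Site d, tlo L y j ≤ x → x ≤ thi L y j → u₁ x = ut x := fun j hj y hy =>
    witness_unitary_of_glev hd1 hL hU₀ hα₀ hα3 hα4 (h33' j hj y hy) hcB0 hsmall hc₃ hsc hα₀ hα3 hαP2 hL1 hBu (h69' j hj y hy) (hP' j hj y hy)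
      (glev_on_towers_of_axial hL1 (Λs (k' + 1)) hAx' h129 j hj y hy)
  -- THE UNIQUENESS JOIN ON THE TORUS, (U1)/(U2)/(1.91) AT PERIODIC ARGUMENTS (`hFP_unique_of_sectE_local_wb_per`, BY NAME) at `ρ := c_u`, `α₃ := 40d·c_B`
  have heq : lam = mu := hFP_unique_of_sectE_local_wb_per (Ω := Ω) (Λs := Λs (k' + 1))
    (Eb := fun j => {b : Site d × Fin d | SideTouches (Ω j) b.1 b.2}) (u₁ := u₁) (A := A') hL hη hU₀ P hΩ0 hEbΩ hEbT g Δ q qs Aw c g_leftB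
    c_left' hΔ hqs hq hq0 hdiv hΛ hU₀per hA'per hu₁per hGper hAw_per H' hα₀ hα3 hα4 hα₃0 hα₄pos hB₀'H hB₂' h33' hwit h129 hH0 hH1 hH2 hHper hQH
    hα₃' hs₁ hs₂ hs₃ hs₄ hs₅ hs₆ hs₇ hsm hprod8 hE_def hE₂_def lE_def lE₂_def hBG hBR hcA0 hcA' hcDA0 ha₁' hb₁' hθ hlE hcu hG hRbd hDA hAd
    h103 h106 hlP hl₁ hD₁ hmult₁ hR₁ hmP hl₂ hD₂ hmult₂ hR₂
  intro x
  rw [hveq, hweq, heq]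

/-! ## §2 Route P's Theorem-2-level uniqueness socket `SockP5Uniq` from the v3 letters at the top truncation -/

section Top

omit [Nontrivial 𝔸] in
/-- `(1/iη) log e^{iηA} = A` bondwise reading at the top weight (`B8Thm2TorusSupplier.logCfg_cfgExp_eq`), restated for the datum of `SockP5Uniq`.
[cite: Balaban1985RegularSpaces, (1.36) p.82, (1.38) p.82] -/
private theorem logCfg_cfgExp_eq' {η : ℝ} (hη : 0 < η) {L : ℕ} (hL1 : 1 ≤ L) (k : ℕ) {c : ℝ} (hc : 0 ≤ c) (hc16 : 16 * c ≤ 1)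
    {A : Site d → Fin d → 𝔸} (hA : ∀ (x : Site d) (κ : Fin d), ‖A x κ‖ ≤ c * ((L : ℝ) ^ k * η)⁻¹) :
    B8Eq138LandauZd.logCfg η (cfgExp η A) = A :=
  B8Thm2TorusSupplier.logCfg_cfgExp_eq hη hL1 k hc hc16 hA

/-- ★ **ROUTE P's THEOREM-2-LEVEL UNIQUENESS SOCKET `SockP5Uniq` FROM THE v3 LETTERS AT THE TOP TRUNCATION** (p. 94 «such a configuration u′ is
unique», used on p. 95; RULING #4): for a `G`-valued `P`-periodic pair (`G ≤ U(𝔸)`) in Theorem 2's regime on `T_η` whose all-levels closeness (1.66)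
is `≤ α₁′`, the v3 letters `ℓ : LettersAtPer … k α₀ P U₀`, the b9 socket at the top truncation, `P ∈ Lᵏℤ` and the uniqueness windows at `(α₀, α₁′)`
(instance `2B₀`, remainder constant `B_R + 2`, radius `α₄ᵘ`, domain `c_u`): `B8Thm2TorusSupplier.SockP5Uniq L k P η c_A c_u G U₀ U′` at
`c_A = 5dLB₀(α₀ + α₁′)` — `sockP5uE_body_of_join_b_per` at `Ω_j = T_η`, `Λ_j = torusLam`, letters = the hybrid letters of `B8Thm2TorusLettersPerConv`
(`g_leftB_H`, `c_left'_H`, `hQH_H`, `gH_per`, `AwH_per`, `HH_per`; bound∕reads laws at all arguments; `hRbd_H` at `B_R + 2`); the competitors of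
`SockP5Uniq` are `P`-periodic by its own binder.
[cite: Balaban1985RegularSpaces, Prop. 5 (1.109) p.94, p.95 (after (1.112)), (1.36) p.82, p.77, §3 p.98; Balaban1985BackgroundPropagators, Thm 3.1 p.397] -/
theorem sockP5Uniq_of_lettersAtPer (hd2 : 2 ≤ d) {L : ℕ} (hL : 2 ≤ L) {η : ℝ} (hη : 0 < η) {k : ℕ} (hk : 1 ≤ k) {P : ℤ}
    (hPdiv : ∃ M : ℤ, P = (L : ℤ) ^ k * M)
    {G : Subgroup 𝔸ˣ} (hGu : G ≤ unitaryUnits 𝔸) {B₀ α₀ α₁' α₄u cu : ℝ} (hα₀ : 0 < α₀) (hα₁' : 0 < α₁') (hB₀ : 0 < B₀)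
    (hα₄u : 0 < α₄u)
    {U₀ U' : Site d → Fin d → 𝔸ˣ} (hU₀G : ∀ x κ, U₀ x κ ∈ G) (hU'G : ∀ x κ, U' x κ ∈ G)
    (hU₀per : ∀ (z : Site d) (i : Fin d), U₀ (z + P • e i) = U₀ z) (hU'per : ∀ (z : Site d) (i : Fin d), U' (z + P • e i) = U' z)
    (h33 : InAk L k η α₀ (fun _ => (Set.univ : Set (Site d))) U₀) (h34 : InAk L k η α₀ (fun _ => (Set.univ : Set (Site d))) (mulCfg U' U₀))
    (hAx : ∀ m', m' ≤ k → InAx L m' (torusLam (d := d) m') U₀ (mulCfg U' U₀))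
    (h135 : ∀ j, j ≤ k → ∀ (z : Site d) (μ : Fin d), (∀ x, InBox (loK L j z) (bondHiK L j z μ) x → x ∈ (fun _ => (Set.univ : Set (Site d))) j) →
      ‖(avgIter L (mulCfg U' U₀) j z μ : 𝔸) - (avgIter L U₀ j z μ : 𝔸)‖ ≤ α₁')
    {B₀β cB9 β : ℝ} {len : Site d → ℝ}
    (SB9 : SockB9P3 (𝔸 := 𝔸) L B₀ B₀β cB9 β len η k (fun _ => (Set.univ : Set (Site d))) (fun m' => torusLam (d := d) m')
      (fun m' => torusLamb (d := d) m'))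
    {BG BR B₀'H B₂' B₀ℓ B₀βℓ cBℓ βℓ : ℝ} {lenℓ : Site d → ℝ} (hB₀'H : 0 < B₀'H) (hB₂' : 0 ≤ B₂') (hBG : 0 ≤ BG) (hBR : 0 ≤ BR)
    (ℓ : LettersAtPer (𝔸 := 𝔸) L BG BR B₀'H B₂' B₀ℓ B₀βℓ cBℓ βℓ lenℓ η k α₀ P U₀)
    (huw : ∀ cs cB cDA hE hE₂ lE lE₂ : ℝ, cs = 5 * (d : ℝ) * L * (2 * B₀) * (α₀ + α₁') → cB = L * cs → cDA = (d : ℝ) * (L : ℝ) ^ 2 * cs →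
      hE = B₀'H * (C2p d * (40 * d * cB + α₄u) * α₄u) → hE₂ = B₂' * (C2p d * (40 * d * cB + α₄u) * α₄u) →
      lE = B₀'H * (4 * C2p d * (40 * d * cB + 2 * α₄u)) → lE₂ = B₂' * (4 * C2p d * (40 * d * cB + 2 * α₄u)) →
      36 * d * (2 * B₀) * cs ≤ 1 / 2 ∧
      8 * (131072 * ((d : ℝ) + 1) ^ 2) * Real.exp (4 * (800 * ((d : ℝ) + 1) ^ 2 * ((d : ℝ) + 4)) * α₀) ≤ 16 * (131072 * ((d : ℝ) + 1) ^ 2) ∧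
      2 * cs ^ 2 + 20 * d * α₀ * cs + 2 * (16 * (131072 * ((d : ℝ) + 1) ^ 2)) * cs ^ 2 ≤ α₀ + α₁' ∧
      (d : ℝ) * L * α₁' ≤ 1 / 8 ∧
      α₀ ≤ cB9 ∧ cs ≤ cB9 ∧
      C0 d * α₀ ≤ 1 / 3 ∧ 4 * α₀ ≤ c2' d L ∧
      Real.exp (4 * (800 * ((d : ℝ) + 1) ^ 2 * ((d : ℝ) + 4)) * α₀) * (1 + 8 * (131072 * ((d : ℝ) + 1) ^ 2) * cB) ≤ 2 ∧
      2 * cB ≤ c3 d L ∧ 2048 * (d : ℝ) * cB ≤ 1 ∧ 40 * d * cB ≤ 1 / 200 ∧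
      200 * C6 d * (2 * α₄u) ≤ 1 ∧ 12000 * ((d : ℝ) + 1) * L * (2 * α₄u) ≤ 1 ∧
      C4G d L * (α₀ + 40 * d * cB + 4 * (2 * α₄u)) ≤ 1 ∧
      1024 * ((d : ℝ) + 1) * ((d : ℝ) + 4) * L ^ 2 * α₀ ≤ 1 ∧ 32 * ((d : ℝ) + 1) ^ 2 * C6 d * L ^ 2 * α₀ ≤ 1 ∧
      16 * d * C5' d * C6 d * (L : ℝ) ^ 2 * α₀ ≤ 1 ∧ 8 * d * C6 d * L * α₀ ≤ 1 ∧
      40 * d * cB + α₄u ≤ 1 / (4 * B₀'H * (2 * C2p d)) ∧ 2 * C6 d * (40 * d * cB + 4 * α₄u) ≤ 1 / 8 ∧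
      cB ≤ 1 / 13 ∧ α₄u / 4 + hE ≤ 1 / 24 ∧ α₄u / 4 + hE ≤ 1 / 140 ∧ 10 * (α₄u / 4 + hE) * (BR + 2) ≤ 1 / 2 ∧
      BG * Mc d (BR + 2) (α₄u / 4 + hE) cB hE₂ cDA ≤ α₄u / 4 ∧
      BG * Kc d (BR + 2) (α₄u / 4 + hE) cB hE₂ cDA lE₂ (1 + lE) (1 + lE) ≤ 1 / 2 ∧
      lE ≤ 1 / 2 ∧ cu + hE ≤ α₄u / 4) :
    SockP5Uniq (𝔸 := 𝔸) L k P η (5 * (d : ℝ) * L * B₀ * (α₀ + α₁')) cu G U₀ U' := by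
  intro u₁ A₁ hu₁G hu₁P h129 hW hsa hbd hLan v w lam mu _ hvP _ hwP hv hw hLv h129v hLw h129w
  have hL1 : 1 ≤ L := le_trans (by norm_num) hL
  have hLr : (1 : ℝ) ≤ L := by exact_mod_cast hL1
  have hU₀ : ∀ x κ, U₀ x κ ∈ unitaryUnits 𝔸 := fun x κ => hGu (hU₀G x κ)
  have hU' : ∀ x κ, U' x κ ∈ unitaryUnits 𝔸 := fun x κ => hGu (hU'G x κ)
  have hu₁ : ∀ x, u₁ x ∈ unitaryUnits 𝔸 := fun x => hGu (hu₁G x)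
  obtain ⟨hΩ, hΩ0, htw, -, -⟩ := torus_member_laws (d := d) hL k
  -- the windows at `(α₀, α₁′)`, instance `2B₀`, remainder constant `B_R + 2`
  obtain ⟨hside2, hC₂, h61₂, hsmall₁, hα₀9, hcs9₂, hα3, hα4, hsmall, hc₃, hsc, hα₃', hs₁, hs₂, hs₃, hs₄, hs₅, hs₆, hs₇, hsm, hprod8, hcA', ha₁',
    hb₁', hθ, h103, h106, hlE, hcu⟩ := huw _ _ _ _ _ _ _ rfl rfl rfl rfl rfl rfl rfl
  have hsum : 0 ≤ α₀ + α₁' := by linarith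
  have hcA0 : 0 ≤ 5 * (d : ℝ) * L * B₀ * (α₀ + α₁') := by positivity
  have hcs2 : 5 * (d : ℝ) * L * (2 * B₀) * (α₀ + α₁') = 2 * (5 * (d : ℝ) * L * B₀ * (α₀ + α₁')) := by ring
  have h12 : 5 * (d : ℝ) * L * B₀ * (α₀ + α₁') ≤ 5 * (d : ℝ) * L * (2 * B₀) * (α₀ + α₁') := by rw [hcs2]; linarith only [hcA0]
  have hcBlo : L * (5 * (d : ℝ) * L * B₀ * (α₀ + α₁')) ≤ L * (5 * (d : ℝ) * L * (2 * B₀) * (α₀ + α₁')) :=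
    mul_le_mul_of_nonneg_left h12 (Nat.cast_nonneg L)
  have hcDAlo : (d : ℝ) * (L : ℝ) ^ 2 * (5 * (d : ℝ) * L * B₀ * (α₀ + α₁')) ≤
      (d : ℝ) * (L : ℝ) ^ 2 * (5 * (d : ℝ) * L * (2 * B₀) * (α₀ + α₁')) :=
    mul_le_mul_of_nonneg_left h12 (by positivity)
  have hside : 36 * d * B₀ * (5 * (d : ℝ) * L * B₀ * (α₀ + α₁')) ≤ 1 / 2 := by
    have hB2 : 36 * (d : ℝ) * B₀ ≤ 36 * d * (2 * B₀) := by nlinarith only [hB₀.le, Nat.cast_nonneg (α := ℝ) d]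
    exact (mul_le_mul hB2 h12 hcA0 (by positivity)).trans hside2
  have h61 : 2 * (5 * (d : ℝ) * L * B₀ * (α₀ + α₁')) ^ 2 + 20 * d * α₀ * (5 * (d : ℝ) * L * B₀ * (α₀ + α₁'))
      + 2 * (16 * (131072 * ((d : ℝ) + 1) ^ 2)) * (5 * (d : ℝ) * L * B₀ * (α₀ + α₁')) ^ 2 ≤ α₀ + α₁' := by
    have hsq : (5 * (d : ℝ) * L * B₀ * (α₀ + α₁')) ^ 2 ≤ (5 * (d : ℝ) * L * (2 * B₀) * (α₀ + α₁')) ^ 2 := pow_le_pow_left₀ hcA0 h12 2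
    have hlin : 20 * d * α₀ * (5 * (d : ℝ) * L * B₀ * (α₀ + α₁')) ≤ 20 * d * α₀ * (5 * (d : ℝ) * L * (2 * B₀) * (α₀ + α₁')) :=
      mul_le_mul_of_nonneg_left h12 (by positivity)
    have hsq2 : 2 * (16 * (131072 * ((d : ℝ) + 1) ^ 2)) * (5 * (d : ℝ) * L * B₀ * (α₀ + α₁')) ^ 2 ≤
        2 * (16 * (131072 * ((d : ℝ) + 1) ^ 2)) * (5 * (d : ℝ) * L * (2 * B₀) * (α₀ + α₁')) ^ 2 := mul_le_mul_of_nonneg_left hsq (by positivity)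
    linarith only [h61₂, hsq, hlin, hsq2]
  have hcs9 : 5 * (d : ℝ) * L * B₀ * (α₀ + α₁') ≤ cB9 := h12.trans hcs9₂
  -- `16 c_A ≤ 1` (from `40d·c_B ≤ 1/200`, `c_A ≤ L·(2c_A) = c_B`, `d ≥ 1`)
  have hcA16 : 16 * (5 * (d : ℝ) * L * B₀ * (α₀ + α₁')) ≤ 1 := by
    have hd0 : (1 : ℝ) ≤ d := by exact_mod_cast (show 1 ≤ d by omega)
    have hcsB : 5 * (d : ℝ) * L * B₀ * (α₀ + α₁') ≤ L * (5 * (d : ℝ) * L * (2 * B₀) * (α₀ + α₁')) :=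
      (le_mul_of_one_le_left hcA0 hLr).trans hcBlo
    have h1 : (d : ℝ) * (5 * (d : ℝ) * L * B₀ * (α₀ + α₁')) ≤ (d : ℝ) * (L * (5 * (d : ℝ) * L * (2 * B₀) * (α₀ + α₁'))) :=
      mul_le_mul_of_nonneg_left hcsB (by positivity)
    have h2 : 5 * (d : ℝ) * L * B₀ * (α₀ + α₁') ≤ (d : ℝ) * (5 * (d : ℝ) * L * B₀ * (α₀ + α₁')) := le_mul_of_one_le_left hcA0 hd0
    linarith only [hα₃', h1, h2]
  -- `U₁ = U′^{u₁⁻¹} = e^{iηA₁}` and its Landau letter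
  have hU₁ : mgauge U₀ u₁⁻¹ U' = cfgExp η A₁ := by rw [← hW]; exact B8Eq131Derivation.mgauge_inv_mgauge U₀ u₁ _
  have hlog : B8Eq138LandauZd.logCfg η (cfgExp η A₁) = A₁ := logCfg_cfgExp_eq' hη hL1 k hcA0 hcA16 hbd
  have hLanW : IsLandau138W L k η ((fun _ => (Set.univ : Set (Site d))) 0) ((fun m' => torusLam (d := d) m') k) U₀ (mgauge U₀ u₁⁻¹ U') := by
    rw [hU₁]
    show IsLandau138 L k η (Set.univ : Set (Site d)) (torusLam k) U₀ (B8Eq138LandauZd.logCfg η (cfgExp η A₁))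
    rw [hlog]; exact hLan
  -- (1.36) on the sides at every `j ≤ k` from the level-`k` bound
  have hA₁ : ∃ A : Site d → Fin d → 𝔸, ∀ j, j ≤ k → ∀ (x : Site d) (κ : Fin d), SideTouches ((fun _ => (Set.univ : Set (Site d))) j) x κ →
      mgauge U₀ u₁⁻¹ U' x κ = cfgExp η A x κ ∧ ‖A x κ‖ ≤ (5 * (d : ℝ) * L * B₀ * (α₀ + α₁')) * ((L : ℝ) ^ j * η)⁻¹ := by
    refine ⟨A₁, fun j hj x κ _ => ⟨by rw [hU₁], (hbd x κ).trans (mul_le_mul_of_nonneg_left ?_ hcA0)⟩⟩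
    rw [mul_inv, mul_inv]
    exact mul_le_mul_of_nonneg_right (inv_anti₀ (by positivity) (pow_le_pow_right₀ hLr hj)) (by positivity)
  -- the competitors' clauses in the JOIN's shape
  have hgrad : ∀ {l : Site d → 𝔸}, (∀ (x : Site d) (κ : Fin d), ((L : ℝ) ^ k * η) * ‖covDerivFwd η U₀ κ l x‖ < cu) →
      ∀ j, j ≤ k → ∀ b ∈ {b : Site d × Fin d | SideTouches ((fun _ => (Set.univ : Set (Site d))) j) b.1 b.2},
        ((L : ℝ) ^ j * η) * ‖covDerivFwd η U₀ b.2 l b.1‖ < cu := by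
    intro l hl j hj b _
    refine lt_of_le_of_lt ?_ (hl b.1 b.2)
    exact mul_le_mul_of_nonneg_right (mul_le_mul_of_nonneg_right (pow_le_pow_right₀ hLr hj) hη.le) (norm_nonneg _)
  -- the torus data of the per engine: every `Lʲ ∣ P`, the constraint sets are shift-invariant
  have hdivP : ∀ j, j ≤ k → ((L : ℤ) ^ j ∣ P) := fun j hj => by
    obtain ⟨M, hM⟩ := hPdiv
    exact ⟨(L : ℤ) ^ (k - j) * M, by rw [hM, ← mul_assoc, ← pow_add, Nat.add_sub_cancel' hj]⟩
  have hΛP : ∀ j, j ≤ k → ∀ (y : Site d) (i : Fin d),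
      y + (P / (L : ℤ) ^ j) • e i ∈ (fun m' => torusLam (d := d) m') k j ↔ y ∈ (fun m' => torusLam (d := d) m') k j :=
    fun j _ y i => by simp only [mem_torusLam_iff]
  have heq := sockP5uE_body_of_join_b_per hd2 hL hη hk P (Ω := fun _ => (Set.univ : Set (Site d))) hΩ hΩ0
    (Λs := fun m' => torusLam (d := d) m') (Λb := fun m' => torusLamb (d := d) m') (fun _ _ _ _ _ _ _ _ => Set.mem_univ _) (torus_hclass k)
    (htw k le_rfl) hdivP hΛP hα₀ hα₁' hB₀ rfl hα₄u hU₀ hU' hU₀per hU'per h33 h34 hAx h135 hu₁ hu₁P h129 hLanW hA₁ SB9 hα₀9 hcs9 hside hC₂ h61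
    hsmall₁
    (gH ℓ k) (covLapₗ η U₀) (qH ℓ k) (QTₗ L k (torusLam (d := d) k) U₀) (AwH ℓ k) (cH ℓ k) (g_leftB_H ℓ hk hU₀per) (c_left'_H ℓ hk)
    hΔ_H hqs_H (hq_H ℓ) (hq0_H ℓ hk) (gH_per ℓ hk le_rfl) (AwH_per ℓ hk le_rfl)
    (HH ℓ k) hB₀'H hB₂' hBG (by linarith : (0 : ℝ) ≤ BR + 2) (hH0_H ℓ hk le_rfl hB₀'H.le) (hH1_H ℓ hk le_rfl hB₀'H.le) (hH2_H ℓ hk le_rfl hB₂')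
    (HH_per ℓ hk le_rfl) (hQH_H ℓ hk le_rfl) (hG_H ℓ hk le_rfl) (hRbd_H ℓ hk le_rfl) hcBlo hcBlo hcDAlo
    hα3 hα4 hsmall hc₃ hsc hα₃' hs₁ hs₂ hs₃ hs₄ hs₅ hs₆ hs₇ hsm hprod8 rfl rfl rfl rfl hcA' ha₁' hb₁' hθ h103 h106 hlE hcu
    (v := v) (w := w) (lam := lam) (mu := mu) hvP hwP (fun x => ⟨(hv x).1, (hv x).2.1, (hv x).2.2.1⟩) (hgrad fun x κ => (hv x).2.2.2 κ)
    (fun x => ⟨(hw x).1, (hw x).2.1, (hw x).2.2.1⟩) (hgrad fun x κ => (hw x).2.2.2 κ) (by rw [hU₁]; exact hLv) h129v (by rw [hU₁]; exact hLw)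
    h129w
  exact funext heq

end Top

#print axioms sockP5uE_body_of_join_b_per
#print axioms sockP5Uniq_of_lettersAtPer

end Literature.MathematicalPhysics.QuantumFieldTheory.Balaban1983to89.B8Thm2TorusUniqPer

end
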